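import Literature.MathematicalPhysics.QuantumFieldTheory.Balaban1983to89.B9Thm311InputsAtOne
import Literature.MathematicalPhysics.QuantumFieldTheory.Balaban1983to89.B9Ineq349SiteAdjoint

/-!
# `Balaban1983to89.B9Thm311AdjointPairs` — [B9] (3.8), (3.9), (3.13) AT def-Y's LETTERS: for unitary-valued configurations the covariant
# divergence `D\*_U` IS the adjoint of the covariant gradient `D_U`, the co-curl IS the adjoint of the curl, `Q\*(U)` IS the adjoint of `Q(U)`
# (real trace pairing), and the symmetry calculus (adjoint sandwiches, two-sided inverses) behind Theorem 3.11's «G is symmetric»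

T. Bałaban, *Propagators for lattice gauge theories in a background field*, Commun. Math. Phys. **99** (1985) 389–434
[`Balaban1985BackgroundPropagators`, "B9"].

statement-level skeleton of published theorems with citation tags; proofs where landed; nothing here is a claim about the
Yang–Mills mass gap

THE PRINTED LOCI (verbatim).  p. 391–392: *"In the sequel we will frequently use adjoint operators to derivatives D. The adjoints are taken with
respect to natural L² scalar products for functions with values in N × N hermitian matrices … for derivative D acting on functions defined at points of
the lattice, the adjoint operator D\* is acting on functions A defined at bonds of the lattice by the formulas (D\*A)(x) = Σ_μ η⁻¹(R(U(x, x − ηe_μ))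
A(x − ηe_μ, x) − A(x, x + ηe_μ)) (3.8).  The operator adjoint to derivative D, acting on functions defined at bonds, is the operator acting on functions F
defined at plaquetts by the formula (D\*F)(x, x + ηe_μ) = Σ_ν (D\*_ν F_{νμ})(x) (3.9)"*; p. 393, (3.13): *"Q\*(U)"* the adjoint of Q(U); p. 416, Thm 3.11:
*"It is a symmetric and invertible operator"*.

WHY THIS FILE.  def-Y types `divY`, `coCurlY`, `QsY` as the transported lifts of the TRANSPOSED kernels along the INVERTED transporters
(`divY_eq_transpose`, `coCurlY_eq_transpose`, `QsY_eq_transpose`) and names them the adjoints; the adjointness itself — print's (3.8), (3.9), (3.13) —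
is a theorem for UNITARY transporters (the adjoint action `R(V)` is then an isometry of the trace pairing, `B9Thm311AdjointAtLetters.trace_conjTranspose_R_mul`).
THIS FILE proves it once for every transported lift (`isAdjTr_trLiftY_transpose`) and instantiates it at the three letter pairs; and it supplies the
algebra of Theorem 3.11's «G is symmetric»: adjoint sandwiches `Q\* ∘ A ∘ Q` of symmetric `A` are symmetric (inverses by n06-i's `isSymmTr_ringInverse`), the Jordan insertion of (3.10) and the (3.25) projection `R(U)` are symmetric — so that «Δ_a(U) symmetric», hence the row-17 clause `symmG`, is
REDUCED to the symmetry of the (3.10) commutator part `curv2Y` (proved in the sequel `B9Thm311Curv2Symm`) and the symmetry of Δ′_a(U) (a theorem at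
def-Y's v4 letters, `B9Thm311DeltaPrimeSymm.deltaPrimeAY_isSymmTr_of_inv_symm` ∕ n06-i's `isSymmTr_GpY_parSymY`) — no invertibility is needed.

* §1 `isAdjTr_trLiftY_transpose` (generic), `isAdjTr_swap`, `isSymmTr_sandwich_of_isAdjTr` (with n06-i's `trIP_comm` ∕ `isSymmTr_ringInverse` from `B9Ineq349SiteAdjoint`).
* §2 `gradT_mem_unitary`, `curlT_mem_unitary`, ★ `isAdjTr_gradY_divY` ((3.8)), ★ `isAdjTr_curlY_coCurlY` ((3.9)), ★ `isAdjTr_QY_QsY(_parBY)` ((3.13)),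
  `isSymmTr_QsY_aY_QY`.
* §3 `holY_mem_unitary`, `conjTranspose_reHolY`, ★ `jordanY_isSymmTr` (the Jordan insertion of (3.10) is symmetric).
* §4 `isAdjTr_reverse`, `isSymmTr_comp_self ∕ _sub ∕ _id`, `GpY_isSymmTr`, `XY_isSymmTr`, ★ `RY_isSymmTr` ((3.25) is symmetric), `gradY_RY_divY_isSymmTr`,
  `coCurlY_jordanY_curlY_isSymmTr`, `aK_isSymm`, ★★ `deltaAY_isSymmTr_of` ∕ `GAY_isSymmTr_of` — «Δ_a(U), G(U) symmetric» REDUCED to: Δ′_a(U) symmetric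
  (a v4 theorem), Q′* the W-adjoint of Q′ (a theorem), and the symmetry of the (3.10) COMMUTATOR PART `curv2Y` (the sequel `B9Thm311Curv2Symm`) — no invertibility needed.

HONEST SCOPE.  Finite-dimensional algebra (trace cyclicity, reindexing); nothing of [B9] is asserted beyond these printed identities, which are PROVED at
def-Y's letters; NOT a node discharge, NOT summit progress; count-neutral; nothing continuum, nothing about the mass gap.  Cell `pub-ymgap` (HUMAN RULING
D-0062), Track A node N06 [B9], seat `pub-ymgap-dag-n06-j` (harness re-seat gen 6), 2026-08-27.
-/

namespace Literature.MathematicalPhysics.QuantumFieldTheory.Balaban1983to89.B9Thm311AdjointPairs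

open Literature.MathematicalPhysics.QuantumFieldTheory.Balaban1983to89
open B9Thm311ReadingCoords B9Thm311AdjointAtLetters B9Thm311DeltaPrimeSymm B9Thm311InputsAtOne B9Ineq349SiteAdjoint Node00
open B6KLevelCensusIndexV1 B9PinMembersKLevelV1 B7Prop2SpecialUnitary
open scoped Matrix

noncomputable section

/-! ## §1 Generic: transposed kernel + inverted unitary transporters = the adjoint; sandwiches; inverses -/

section Generic

open scoped Matrix.Norms.L2Operator

variable {N : ℕ} {X Y : Type} [Fintype X] [Fintype Y]

/-- ★ **THE TRANSPORTED LIFT OF THE TRANSPOSED KERNEL ALONG THE INVERTED TRANSPORTERS IS THE ADJOINT** for the weight-1 trace pairings, whenever the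
transporters on the support of the kernel are unitary: `⟨M♯_T Φ, Ψ⟩ = ⟨Φ, (Mᵀ)♯_{T⁻¹} Ψ⟩` — the common mechanism of (3.8), (3.9), (3.13).
[cite: Balaban1985BackgroundPropagators, (3.8)–(3.9) p.392, (3.13) p.393] -/
theorem isAdjTr_trLiftY_transpose (M : Matrix Y X ℝ) (T : Y → X → (Matrix (Fin N) (Fin N) ℂ)ˣ)
    (hT : ∀ y x, M y x ≠ 0 → ((T y x : (Matrix (Fin N) (Fin N) ℂ)ˣ) : Matrix (Fin N) (Fin N) ℂ) ∈ unitary (Matrix (Fin N) (Fin N) ℂ)) :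
    IsAdjTr (fun _ => (1 : ℝ)) (fun _ => (1 : ℝ)) (trLiftY M T) (trLiftY Mᵀ fun x y => (T y x)⁻¹) := by
  intro Φ Ψ
  rw [trIP_eq_re_trace, trIP_eq_re_trace]
  simp only [one_mul]
  have hterm : ∀ y x, M y x * (Matrix.trace ((B9Eq39Adjoint.R (T y x) (Φ x))ᴴ * Ψ y)).re =
      Mᵀ x y * (Matrix.trace ((Φ x)ᴴ * B9Eq39Adjoint.R (T y x)⁻¹ (Ψ y))).re := by
    intro y x
    rw [Matrix.transpose_apply]
    by_cases h0 : M y x = 0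
    · rw [h0, zero_mul, zero_mul]
    · rw [trace_conjTranspose_R_mul _ (hT y x h0)]
  have hL : ∀ y, (Matrix.trace ((trLiftY M T Φ y)ᴴ * Ψ y)).re =
      ∑ x, M y x * (Matrix.trace ((B9Eq39Adjoint.R (T y x) (Φ x))ᴴ * Ψ y)).re := fun y =>
    re_trace_conjTranspose_trLiftY_mul M T Φ (Ψ y) y
  have hR : ∀ x, (Matrix.trace ((Φ x)ᴴ * (trLiftY Mᵀ fun x y => (T y x)⁻¹) Ψ x)).re =
      ∑ y, Mᵀ x y * (Matrix.trace ((Φ x)ᴴ * B9Eq39Adjoint.R (T y x)⁻¹ (Ψ y))).re := fun x =>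
    re_trace_conjTranspose_mul_trLiftY Mᵀ (fun x y => (T y x)⁻¹) Ψ (Φ x) x
  simp_rw [hL, hR, hterm]
  rw [Finset.sum_comm]

variable {S S' : Type} [Fintype S] [Fintype S']

/-- an adjoint pair read backwards. [cite: Balaban1985BackgroundPropagators, p.392 (adjoints), bookkeeping] -/
theorem isAdjTr_swap {wX : S → ℝ} {wY : S' → ℝ} {Q : (S → Matrix (Fin N) (Fin N) ℂ) →ₗ[ℂ] (S' → Matrix (Fin N) (Fin N) ℂ)}
    {Qs : (S' → Matrix (Fin N) (Fin N) ℂ) →ₗ[ℂ] (S → Matrix (Fin N) (Fin N) ℂ)} (h : IsAdjTr wX wY Q Qs) (Ψ : S' → Matrix (Fin N) (Fin N) ℂ)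
    (Φ : S → Matrix (Fin N) (Fin N) ℂ) : trIP wX (Qs Ψ) Φ = trIP wY Ψ (Q Φ) := by
  rw [trIP_comm wX, ← h, trIP_comm wY]

/-- ★ **AN ADJOINT SANDWICH OF A SYMMETRIC OPERATOR IS SYMMETRIC**: `Q\* ∘ A ∘ Q` with `Q\*` the adjoint of `Q` and `A` symmetric — the shape of
`Q\*(U)aQ(U)` in (3.26), of `D_U R(U) D\*_U`, and of `D\* ∘ 𝒦 ∘ D` in (3.10). [cite: Balaban1985BackgroundPropagators, (3.26) p.395, (3.10) p.392] -/
theorem isSymmTr_sandwich_of_isAdjTr {wX : S → ℝ} {wY : S' → ℝ} {Q : (S → Matrix (Fin N) (Fin N) ℂ) →ₗ[ℂ] (S' → Matrix (Fin N) (Fin N) ℂ)}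
    {Qs : (S' → Matrix (Fin N) (Fin N) ℂ) →ₗ[ℂ] (S → Matrix (Fin N) (Fin N) ℂ)} {A : (S' → Matrix (Fin N) (Fin N) ℂ) →ₗ[ℂ] (S' → Matrix (Fin N) (Fin N) ℂ)}
    (hQ : IsAdjTr wX wY Q Qs) (hA : IsSymmTr wY A) : IsSymmTr wX (Qs ∘ₗ A ∘ₗ Q) := by
  intro Φ Ψ
  simp only [LinearMap.comp_apply]
  rw [isAdjTr_swap hQ, hA, ← hQ]

end Generic

/-! ## §2 (3.8), (3.9), (3.13) at def-Y's letters -/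

section Letters

open scoped Matrix.Norms.L2Operator

variable {d ℓ : ℕ} {hd : 1 ≤ d + 1} {hL : Odd (ℓ + 1) ∧ 1 < ℓ + 1} {b₀ b₁ : ℝ} {N : ℕ}
variable (i : KIdx d ℓ hd hL b₀ b₁)

/-- the gradient transporter table is unitary at a unitary-valued configuration (its values are `U(b)` or `1`). [cite: Balaban1985BackgroundPropagators, (3.3) p.390, bookkeeping] -/
theorem gradT_mem_unitary (U : CfgY (Matrix (Fin N) (Fin N) ℂ) i)
    (hU : ∀ μ x, ((U μ x : (Matrix (Fin N) (Fin N) ℂ)ˣ) : Matrix (Fin N) (Fin N) ℂ) ∈ unitary (Matrix (Fin N) (Fin N) ℂ)) (b : FBondY i) (z : SiteY i) :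
    ((gradT i U b z : (Matrix (Fin N) (Fin N) ℂ)ˣ) : Matrix (Fin N) (Fin N) ℂ) ∈ unitary (Matrix (Fin N) (Fin N) ℂ) := by
  unfold gradT
  split_ifs
  · exact hU _ _
  · rw [Units.val_one]; exact (unitary _).one_mem

/-- the curl transporter table is unitary at a unitary-valued configuration. [cite: Balaban1985BackgroundPropagators, (3.4) p.391, bookkeeping] -/
theorem curlT_mem_unitary (U : CfgY (Matrix (Fin N) (Fin N) ℂ) i)
    (hU : ∀ μ x, ((U μ x : (Matrix (Fin N) (Fin N) ℂ)ˣ) : Matrix (Fin N) (Fin N) ℂ) ∈ unitary (Matrix (Fin N) (Fin N) ℂ)) (p : PlaqY i) (b : FBondY i) :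
    ((curlT i U p b : (Matrix (Fin N) (Fin N) ℂ)ˣ) : Matrix (Fin N) (Fin N) ℂ) ∈ unitary (Matrix (Fin N) (Fin N) ℂ) := by
  unfold curlT
  split_ifs
  · exact hU _ _
  · exact hU _ _
  · rw [Units.val_one]; exact (unitary _).one_mem

/-- ★ **(3.8) AT THE LETTERS: `D*_U` IS THE ADJOINT OF `D_U`** (sites → bonds) for the trace pairings, at every unitary-valued configuration.
[cite: Balaban1985BackgroundPropagators, (3.8) p.392] -/
theorem isAdjTr_gradY_divY (U : CfgY (Matrix (Fin N) (Fin N) ℂ) i)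
    (hU : ∀ μ x, ((U μ x : (Matrix (Fin N) (Fin N) ℂ)ˣ) : Matrix (Fin N) (Fin N) ℂ) ∈ unitary (Matrix (Fin N) (Fin N) ℂ)) :
    IsAdjTr (fun _ => (1 : ℝ)) (fun _ => (1 : ℝ)) (gradY i U) (divY i U) := by
  rw [divY_eq_transpose]
  exact isAdjTr_trLiftY_transpose (gradK i) (gradT i U) fun b z _ => gradT_mem_unitary i U hU b z

/-- ★ **(3.9) AT THE LETTERS: the co-curl IS THE ADJOINT OF THE CURL** (bonds → plaquettes), at every unitary-valued configuration.
[cite: Balaban1985BackgroundPropagators, (3.9) p.392] -/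
theorem isAdjTr_curlY_coCurlY (U : CfgY (Matrix (Fin N) (Fin N) ℂ) i)
    (hU : ∀ μ x, ((U μ x : (Matrix (Fin N) (Fin N) ℂ)ˣ) : Matrix (Fin N) (Fin N) ℂ) ∈ unitary (Matrix (Fin N) (Fin N) ℂ)) :
    IsAdjTr (fun _ => (1 : ℝ)) (fun _ => (1 : ℝ)) (curlY i U) (coCurlY i U) := by
  rw [coCurlY_eq_transpose]
  exact isAdjTr_trLiftY_transpose (curlK i) (curlT i U) fun p b _ => curlT_mem_unitary i U hU p b

/-- ★ **(3.13) AT THE LETTERS: `Q*(U)` IS THE ADJOINT OF `Q(U)`** (fine bonds → coarse bonds) whenever the bond transporter table is `G`-valued, `G ≤ U(N)`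
(def-Y's taxicab `parBY` at a `G`-valued configuration: `parBY_mem`). [cite: Balaban1985BackgroundPropagators, (3.13) p.393] -/
theorem isAdjTr_QY_QsY {G : Subgroup (Matrix (Fin N) (Fin N) ℂ)ˣ} (hG : G ≤ B7Prop2Explicit.unitaryUnits (Matrix (Fin N) (Fin N) ℂ))
    (parB : BondParY (Matrix (Fin N) (Fin N) ℂ) i) (U : CfgY (Matrix (Fin N) (Fin N) ℂ) i) (hpar : ∀ s s', parB U s s' ∈ G) :
    IsAdjTr (fun _ => (1 : ℝ)) (fun _ => (1 : ℝ)) (QY i parB U) (QsY i parB U) := by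
  rw [QsY_eq_transpose]
  exact isAdjTr_trLiftY_transpose (qK i) (qT i parB U) fun ι b _ => hG (hpar _ _)

/-- (3.13) at def-Y's taxicab bond transporters `parBY` for a `G`-valued configuration, `G ≤ U(N)`. [cite: Balaban1985BackgroundPropagators, (3.13) p.393, (3.35) p.396] -/
theorem isAdjTr_QY_QsY_parBY {G : Subgroup (Matrix (Fin N) (Fin N) ℂ)ˣ} (hG : G ≤ B7Prop2Explicit.unitaryUnits (Matrix (Fin N) (Fin N) ℂ))
    (U : CfgY (Matrix (Fin N) (Fin N) ℂ) i) (hU : ∀ μ x, U μ x ∈ G) :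
    IsAdjTr (fun _ => (1 : ℝ)) (fun _ => (1 : ℝ)) (QY i (parBY i) U) (QsY i (parBY i) U) :=
  isAdjTr_QY_QsY i hG (parBY i) U fun s s' => parBY_mem i hU s s'

/-- ★ the term `Q*(U) a Q(U)` of (3.26) is symmetric at `G`-valued data (an adjoint sandwich of the symmetric weight operator `a`, a lift of a diagonal
real matrix). [cite: Balaban1985BackgroundPropagators, (3.26) p.395] -/
theorem isSymmTr_QsY_aY_QY {G : Subgroup (Matrix (Fin N) (Fin N) ℂ)ˣ} (hG : G ≤ B7Prop2Explicit.unitaryUnits (Matrix (Fin N) (Fin N) ℂ))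
    (parB : BondParY (Matrix (Fin N) (Fin N) ℂ) i) (U : CfgY (Matrix (Fin N) (Fin N) ℂ) i) (hpar : ∀ s s', parB U s s' ∈ G)
    (ha : (aK i).IsSymm) : IsSymmTr (fun _ => (1 : ℝ)) (QsY i parB U ∘ₗ aY i ∘ₗ QY i parB U) :=
  isSymmTr_sandwich_of_isAdjTr (isAdjTr_QY_QsY i hG parB U hpar) (isSymmTr_liftOpY (aK i) ha)

end Letters

/-! ## §3 The Jordan insertion `𝒦_U` of the Hessian (3.10) is symmetric at unitary holonomies -/

section Jordan

open scoped Matrix.Norms.L2Operator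

variable {d ℓ : ℕ} {hd : 1 ≤ d + 1} {hL : Odd (ℓ + 1) ∧ 1 < ℓ + 1} {b₀ b₁ : ℝ} {N : ℕ}
variable (i : KIdx d ℓ hd hL b₀ b₁)

/-- the plaquette holonomy of a unitary-valued configuration is unitary. [cite: Balaban1985BackgroundPropagators, (3.1) p.390, bookkeeping] -/
theorem holY_mem_unitary (U : CfgY (Matrix (Fin N) (Fin N) ℂ) i)
    (hU : ∀ μ x, ((U μ x : (Matrix (Fin N) (Fin N) ℂ)ˣ) : Matrix (Fin N) (Fin N) ℂ) ∈ unitary (Matrix (Fin N) (Fin N) ℂ)) (p : PlaqY i) :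
    ((holY i U p : (Matrix (Fin N) (Fin N) ℂ)ˣ) : Matrix (Fin N) (Fin N) ℂ) ∈ unitary (Matrix (Fin N) (Fin N) ℂ) := by
  have hU' : ∀ μ x, U μ x ∈ B7Prop2Explicit.unitaryUnits (Matrix (Fin N) (Fin N) ℂ) := hU
  unfold holY
  exact (B7Prop2Explicit.unitaryUnits _).mul_mem ((B7Prop2Explicit.unitaryUnits _).mul_mem
    ((B7Prop2Explicit.unitaryUnits _).mul_mem (hU' _ _) (hU' _ _)) ((B7Prop2Explicit.unitaryUnits _).inv_mem (hU' _ _)))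
    ((B7Prop2Explicit.unitaryUnits _).inv_mem (hU' _ _))

/-- `Re U(∂p)` is Hermitian at a unitary holonomy: `(½(V + V⁻¹))* = ½(V⁻¹ + V)`. [cite: Balaban1985BackgroundPropagators, (3.7) p.391, bookkeeping] -/
theorem conjTranspose_reHolY (U : CfgY (Matrix (Fin N) (Fin N) ℂ) i)
    (hU : ∀ μ x, ((U μ x : (Matrix (Fin N) (Fin N) ℂ)ˣ) : Matrix (Fin N) (Fin N) ℂ) ∈ unitary (Matrix (Fin N) (Fin N) ℂ)) (p : PlaqY i) :
    (reHolY i U p)ᴴ = reHolY i U p := by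
  have hV := holY_mem_unitary i U hU p
  have h1 : (((holY i U p)⁻¹ : (Matrix (Fin N) (Fin N) ℂ)ˣ) : Matrix (Fin N) (Fin N) ℂ) = ((holY i U p : (Matrix (Fin N) (Fin N) ℂ)ˣ) : Matrix _ _ ℂ)ᴴ :=
    val_inv_eq_conjTranspose _ hV
  unfold reHolY
  rw [h1, Matrix.conjTranspose_smul, Matrix.conjTranspose_add, Matrix.conjTranspose_conjTranspose, add_comm]
  congr 1
  rw [Complex.star_def, map_div₀, map_one, map_ofNat]

/-- ★ **THE JORDAN INSERTION `𝒦_U F = ½(F·Re U(∂p) + Re U(∂p)·F)` IS SYMMETRIC** for the trace pairing at a unitary-valued configuration (polarisation of the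
first term `tr((D_UA)(p))²·Re U(∂p)` of (3.10)). [cite: Balaban1985BackgroundPropagators, (3.7) p.391, (3.10) p.392] -/
theorem jordanY_isSymmTr (U : CfgY (Matrix (Fin N) (Fin N) ℂ) i)
    (hU : ∀ μ x, ((U μ x : (Matrix (Fin N) (Fin N) ℂ)ˣ) : Matrix (Fin N) (Fin N) ℂ) ∈ unitary (Matrix (Fin N) (Fin N) ℂ)) :
    IsSymmTr (fun _ => (1 : ℝ)) (jordanY i U) := by
  intro F G
  rw [trIP_one_eq, trIP_one_eq]
  congr 1
  refine Finset.sum_congr rfl fun p _ => ?_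
  set W := reHolY i U p with hW
  have hWh : Wᴴ = W := conjTranspose_reHolY i U hU p
  rw [jordanY_apply, jordanY_apply, ← hW, Matrix.conjTranspose_smul, Matrix.conjTranspose_add, Matrix.conjTranspose_mul, Matrix.conjTranspose_mul,
    hWh, Matrix.smul_mul, Matrix.mul_smul, Matrix.trace_smul, Matrix.trace_smul, Matrix.add_mul, Matrix.mul_add, Matrix.trace_add, Matrix.trace_add]
  have hc : star (1 / 2 : ℂ) = 1 / 2 := by rw [Complex.star_def, map_div₀, map_one, map_ofNat]
  rw [hc, Matrix.mul_assoc, Matrix.trace_mul_comm W ((F p)ᴴ * G p), Matrix.mul_assoc, Matrix.mul_assoc, add_comm]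

end Jordan

/-! ## §4 The (3.25) projection `R(U)` and the three sandwiches of `Δ_a(U)` (3.26); «G symmetric» reduced to the commutator part of (3.10) -/

section DeltaA

open scoped Matrix.Norms.L2Operator

variable {N : ℕ} {S S' : Type} [Fintype S] [Fintype S']

/-- an adjoint pair, reversed. [cite: Balaban1985BackgroundPropagators, p.392 (adjoints), bookkeeping] -/
theorem isAdjTr_reverse {wX : S → ℝ} {wY : S' → ℝ} {Q : (S → Matrix (Fin N) (Fin N) ℂ) →ₗ[ℂ] (S' → Matrix (Fin N) (Fin N) ℂ)}
    {Qs : (S' → Matrix (Fin N) (Fin N) ℂ) →ₗ[ℂ] (S → Matrix (Fin N) (Fin N) ℂ)} (h : IsAdjTr wX wY Q Qs) : IsAdjTr wY wX Qs Q :=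
  fun Ψ Φ => isAdjTr_swap h Ψ Φ

/-- a symmetric operator composed with itself is symmetric. [cite: Balaban1985BackgroundPropagators, (3.25) p.395 (G′²), bookkeeping] -/
theorem isSymmTr_comp_self {w : S → ℝ} {A : Module.End ℂ (S → Matrix (Fin N) (Fin N) ℂ)} (hA : IsSymmTr w A) : IsSymmTr w (A ∘ₗ A) :=
  fun Φ Ψ => by simp only [LinearMap.comp_apply]; rw [hA, hA]

/-- symmetric operators subtract. [cite: Balaban1985BackgroundPropagators, (3.25) p.395 (I − …), bookkeeping] -/
theorem isSymmTr_sub {w : S → ℝ} {A B : Module.End ℂ (S → Matrix (Fin N) (Fin N) ℂ)} (hA : IsSymmTr w A) (hB : IsSymmTr w B) :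
    IsSymmTr w (A - B) := by
  intro Φ Ψ
  have hl : trIP w ((A - B) Φ) Ψ = trIP w (A Φ) Ψ - trIP w (B Φ) Ψ := by
    simp only [trIP, LinearMap.sub_apply, Pi.sub_apply, Matrix.sub_apply, star_sub, sub_mul, Complex.sub_re, Finset.sum_sub_distrib, mul_sub]
  have hr : trIP w Φ ((A - B) Ψ) = trIP w Φ (A Ψ) - trIP w Φ (B Ψ) := by
    simp only [trIP, LinearMap.sub_apply, Pi.sub_apply, Matrix.sub_apply, mul_sub, Complex.sub_re, Finset.sum_sub_distrib]
  rw [hl, hr, hA, hB]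

/-- the identity is symmetric. [cite: Balaban1985BackgroundPropagators, (3.25) p.395, bookkeeping] -/
theorem isSymmTr_id (w : S → ℝ) : IsSymmTr w (LinearMap.id : Module.End ℂ (S → Matrix (Fin N) (Fin N) ℂ)) := fun _ _ => rfl

variable {d ℓ : ℕ} {hd : 1 ≤ d + 1} {hL : Odd (ℓ + 1) ∧ 1 < ℓ + 1} {b₀ b₁ : ℝ}
variable (i : KIdx d ℓ hd hL b₀ b₁)

/-- `G′(U) = Ring.inverse Δ′_a(U)` is symmetric when Δ′_a(U) is symmetric (for any table; n06-i's `isSymmTr_GpY_parSymY` is the v4 instance). [cite: Balaban1985BackgroundPropagators, (3.25) p.395, Thm 3.11 p.416] -/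
theorem GpY_isSymmTr (parS : SiteParY (Matrix (Fin N) (Fin N) ℂ) i) (U : CfgY (Matrix (Fin N) (Fin N) ℂ) i)
    (hΔ : IsSymmTr (fun _ => (1 : ℝ)) (deltaPrimeAY i parS U)) : IsSymmTr (fun _ => (1 : ℝ)) (GpY i parS U) :=
  isSymmTr_ringInverse _ hΔ

/-- `(Q′G′²Q′*)(U)` is symmetric for the block-volume pairing when G′(U) is symmetric and Q′*(U) is the adjoint of Q′(U).
[cite: Balaban1985BackgroundPropagators, (3.25) p.395; Balaban1984PropagatorsII, (2.69) p.235] -/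
theorem XY_isSymmTr (parS : SiteParY (Matrix (Fin N) (Fin N) ℂ) i) (Gp : SiteOpY (Matrix (Fin N) (Fin N) ℂ) i) (U : CfgY (Matrix (Fin N) (Fin N) ℂ) i)
    (hGp : IsSymmTr (fun _ => (1 : ℝ)) (Gp U)) (hadj : IsAdjTr (fun _ => (1 : ℝ)) (B9Thm311ReadingAtLetters.wB i) (QpY i parS U) (QpsY i parS U)) :
    IsSymmTr (B9Thm311ReadingAtLetters.wB i) (XY i parS Gp U) := by
  have h := isSymmTr_sandwich_of_isAdjTr (isAdjTr_reverse hadj) (isSymmTr_comp_self hGp)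
  rw [XY]
  simpa only [LinearMap.comp_assoc] using h

/-- ★ the (3.25) projection `R(U) = I − G′Q′*(Q′G′²Q′*)⁻¹Q′G′` is symmetric (print: *"an orthogonal projection"*, (3.20)) when G′(U) is symmetric, Q′*(U) is the
adjoint of Q′(U) (no invertibility needed: `Ring.inverse` of a non-unit is `0`). [cite: Balaban1985BackgroundPropagators, (3.20)–(3.21) p.394, (3.25) p.395] -/
theorem RY_isSymmTr (parS : SiteParY (Matrix (Fin N) (Fin N) ℂ) i) (Gp : SiteOpY (Matrix (Fin N) (Fin N) ℂ) i) (U : CfgY (Matrix (Fin N) (Fin N) ℂ) i)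
    (hGp : IsSymmTr (fun _ => (1 : ℝ)) (Gp U)) (hadj : IsAdjTr (fun _ => (1 : ℝ)) (B9Thm311ReadingAtLetters.wB i) (QpY i parS U) (QpsY i parS U)) :
    IsSymmTr (fun _ => (1 : ℝ)) (RY i parS Gp U) := by
  have hS : IsSymmTr (fun _ => (1 : ℝ)) (QpsY i parS U ∘ₗ XinvY i parS Gp U ∘ₗ QpY i parS U) :=
    isSymmTr_sandwich_of_isAdjTr hadj (isSymmTr_ringInverse _ (XY_isSymmTr i parS Gp U hGp hadj))
  have hT : IsSymmTr (fun _ => (1 : ℝ)) (Gp U ∘ₗ (QpsY i parS U ∘ₗ XinvY i parS Gp U ∘ₗ QpY i parS U) ∘ₗ Gp U) :=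
    isSymmTr_sandwich_of_isAdjTr (Q := Gp U) (Qs := Gp U) hGp hS
  rw [RY]
  refine isSymmTr_sub (isSymmTr_id _) ?_
  simpa only [LinearMap.comp_assoc] using hT

/-- ★ the middle term `D_U R(U) D*_U` of (3.26) is symmetric at a unitary-valued configuration when `R(U)` is. [cite: Balaban1985BackgroundPropagators, (3.26) p.395, (3.8) p.392] -/
theorem gradY_RY_divY_isSymmTr (parS : SiteParY (Matrix (Fin N) (Fin N) ℂ) i) (Gp : SiteOpY (Matrix (Fin N) (Fin N) ℂ) i)
    (U : CfgY (Matrix (Fin N) (Fin N) ℂ) i)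
    (hU : ∀ μ x, ((U μ x : (Matrix (Fin N) (Fin N) ℂ)ˣ) : Matrix (Fin N) (Fin N) ℂ) ∈ unitary (Matrix (Fin N) (Fin N) ℂ))
    (hR : IsSymmTr (fun _ => (1 : ℝ)) (RY i parS Gp U)) : IsSymmTr (fun _ => (1 : ℝ)) (gradY i U ∘ₗ RY i parS Gp U ∘ₗ divY i U) :=
  isSymmTr_sandwich_of_isAdjTr (isAdjTr_reverse (isAdjTr_gradY_divY i U hU)) hR

/-- ★ the first term `D*_U 𝒦_U D_U` of the Hessian (3.10) is symmetric at a unitary-valued configuration. [cite: Balaban1985BackgroundPropagators, (3.10) p.392, (3.9) p.392] -/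
theorem coCurlY_jordanY_curlY_isSymmTr (U : CfgY (Matrix (Fin N) (Fin N) ℂ) i)
    (hU : ∀ μ x, ((U μ x : (Matrix (Fin N) (Fin N) ℂ)ˣ) : Matrix (Fin N) (Fin N) ℂ) ∈ unitary (Matrix (Fin N) (Fin N) ℂ)) :
    IsSymmTr (fun _ => (1 : ℝ)) (coCurlY i U ∘ₗ jordanY i U ∘ₗ curlY i U) :=
  isSymmTr_sandwich_of_isAdjTr (isAdjTr_curlY_coCurlY i U hU) (jordanY_isSymmTr i U hU)

/-- the weight kernel `aK` is a diagonal, hence symmetric, real matrix. [cite: Balaban1984PropagatorsII, (2.18)–(2.20) p.226 («a multiplication operator»)] -/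
theorem aK_isSymm : (aK i).IsSymm := by
  refine Matrix.IsSymm.ext_iff.2 fun a b => ?_
  simp only [aK, B6SectAOperatorsV1.aE, B6Ineq2133TwoScaleV1.onFun_onE, LinearMap.toMatrix'_apply, B6SectAOperatorsV1.diagFn,
    LinearMap.coe_mk, AddHom.coe_mk]
  by_cases h : a = b
  · subst h; rfl
  · rw [Pi.single_eq_of_ne (Ne.symm h), Pi.single_eq_of_ne h, mul_zero, mul_zero]

/-- ★★ **«Δ_a(U) IS SYMMETRIC» REDUCED TO THE COMMUTATOR PART OF THE HESSIAN**: at `G`-valued data (`G ≤ U(N)`) with a symmetric invertible Δ′_a(U),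
Q′*(U) the `W`-adjoint of Q′(U), (Q′G′²Q′*)(U) invertible and the (3.10) commutator part `Δ′₂(U)` symmetric, def-Y's `Δ_a(U) = Δ(U) + D_UR(U)D*_U +
Q*(U)aQ(U)` with `G′ := GpY` is symmetric for the trace pairing. [cite: Balaban1985BackgroundPropagators, (3.26) p.395, (3.10) p.392, Thm 3.11 p.416] -/
theorem deltaAY_isSymmTr_of {G : Subgroup (Matrix (Fin N) (Fin N) ℂ)ˣ} (hG : G ≤ B7Prop2Explicit.unitaryUnits (Matrix (Fin N) (Fin N) ℂ))
    (parS : SiteParY (Matrix (Fin N) (Fin N) ℂ) i) (parB : BondParY (Matrix (Fin N) (Fin N) ℂ) i) (U : CfgY (Matrix (Fin N) (Fin N) ℂ) i)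
    (hU : ∀ μ x, U μ x ∈ G) (hparB : ∀ s s', parB U s s' ∈ G) (hΔ' : IsSymmTr (fun _ => (1 : ℝ)) (deltaPrimeAY i parS U))
    (hadj : IsAdjTr (fun _ => (1 : ℝ)) (B9Thm311ReadingAtLetters.wB i) (QpY i parS U) (QpsY i parS U))
    (hcurv : IsSymmTr (fun _ => (1 : ℝ)) (curv2Y i U)) :
    IsSymmTr (fun _ => (1 : ℝ)) (deltaAY i parS parB (GpY i parS) U) := by
  have hU' : ∀ μ x, ((U μ x : (Matrix (Fin N) (Fin N) ℂ)ˣ) : Matrix (Fin N) (Fin N) ℂ) ∈ unitary (Matrix (Fin N) (Fin N) ℂ) := fun μ x => hG (hU μ x)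
  have hGp : IsSymmTr (fun _ => (1 : ℝ)) (GpY i parS U) := GpY_isSymmTr i parS U hΔ'
  rw [deltaAY, hessY]
  refine isSymmTr_add _ (isSymmTr_add _ (isSymmTr_add _ (coCurlY_jordanY_curlY_isSymmTr i U hU') hcurv)
    (gradY_RY_divY_isSymmTr i parS (GpY i parS) U hU' (RY_isSymmTr i parS (GpY i parS) U hGp hadj))) ?_
  exact isSymmTr_QsY_aY_QY i hG parB U hparB (aK_isSymm i)

/-- ★★ **«G(U) = Δ_a(U)⁻¹ IS SYMMETRIC»** under the same inputs (`Ring.inverse` keeps symmetry, invertible or not) — the row-17 clause `symmG` at letters with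
`GA := GAY …`, reduced to the symmetry of the (3.10) commutator part. [cite: Balaban1985BackgroundPropagators, (3.27) p.395, Thm 3.11 p.416] -/
theorem GAY_isSymmTr_of {G : Subgroup (Matrix (Fin N) (Fin N) ℂ)ˣ} (hG : G ≤ B7Prop2Explicit.unitaryUnits (Matrix (Fin N) (Fin N) ℂ))
    (parS : SiteParY (Matrix (Fin N) (Fin N) ℂ) i) (parB : BondParY (Matrix (Fin N) (Fin N) ℂ) i) (U : CfgY (Matrix (Fin N) (Fin N) ℂ) i)
    (hU : ∀ μ x, U μ x ∈ G) (hparB : ∀ s s', parB U s s' ∈ G) (hΔ' : IsSymmTr (fun _ => (1 : ℝ)) (deltaPrimeAY i parS U))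
    (hadj : IsAdjTr (fun _ => (1 : ℝ)) (B9Thm311ReadingAtLetters.wB i) (QpY i parS U) (QpsY i parS U))
    (hcurv : IsSymmTr (fun _ => (1 : ℝ)) (curv2Y i U)) : IsSymmTr (fun _ => (1 : ℝ)) (GAY i parS parB (GpY i parS) U) :=
  isSymmTr_ringInverse _ (deltaAY_isSymmTr_of i hG parS parB U hU hparB hΔ' hadj hcurv)

end DeltaA

end

end Literature.MathematicalPhysics.QuantumFieldTheory.Balaban1983to89.B9Thm311AdjointPairs
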